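import Literature.NumberTheory.LFunctions.ConreyIwaniec2002CircleMethodFourier
import Literature.NumberTheory.LFunctions.ConreyIwaniec2002CircleMethodDivisorSums
import HarnessLib

/-!
# Conrey–Iwaniec (2002), proof of Theorem 4.1: the expansion of `V_c(α)` and the Kloosterman step

B. Conrey, H. Iwaniec, *Spacing of zeros of Hecke `L`-functions and the class number problem*,
Acta Arith. 103 (2002) 259–312, §4, proof of Theorem 4.1 [held text `paper:arxiv-math_0111012`,
p0011:L1–45]: "By the summation formula (4.3) we have
`S(a/c − α) = Σ_{m ≥ 0} ψ_m(a)e(d l_m/c)ĝ_m(α)`. Inserting this into (4.12) and changing the order of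
summation we get `V_c(α) = Σ_{m₁}Σ_{m₂} ĝ_{m₁}(α)conj(ĝ_{m₂}(α)) Σ*_{d ∈ I} ψ_{m₁}(a)ψ̄_{m₂}(a)
e(d(l_{m₁} − l_{m₂})/c − ah/c)` … incomplete Kloosterman sums for which Weil's bound yields (4.14)
… We derive for any `α`: `V_c(α) = |ĝ(α)p(c)|²{Σ*_{d ∈ I} e(−ah/c) + …} + O(A²(h,c)^{1/2}c^{3/2}τ(c)
(log C)(|ĝ(α)| + Σ_1^∞τ(m)|ĝ_m(α)|)(Σ_1^∞τ(m)|ĝ_m(α)|))` by (4.4), (4.7) and (4.14)."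

This file proves that step for the assembly of Theorem 4.1 (registered stub S3b3
`stub_circle_assembly` of SKELETON S3, cell `landau-siegel/ls-inputs`, line `theta-circle-method`),
over the typed datum `IsVoronoiDatum` (product form `ψ_m(a) = u_c(a)φ_c(m)`, `|u_c(a)| = 1`, which is
what makes `ψ_{m₁}(a)ψ̄_{m₂}(a)` independent of `a`), the kernel bound `KernelFourierBound` (4.5)
and the registered input `IncompleteKloostermanBound K₀` (4.14):

* `hasSum_voronoi_fourier` — (4.3) at the test function `g(x)e(−αx)`:
  `S(a/c − α) = u_c(a)(p(c)ĝ(α) + Σ_{m ≥ 1} φ_c(m)e(ā l_m/c)ĝ_m(α))`;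
* `summable_norm_coeff_mul_fourier`, `tsum_norm_coeff_mul_fourier_le` — by (4.4)–(4.5),
  `Σ_{m ≥ 1}|φ_c(m)ĝ_m(α)| ≤ A·B·C·K₅₄²` for `c ≤ C = 2√(qX)`, `|α| ≤ (cC)^{-1}`;
* `norm_sum_mul_tsum_le`, `norm_sum_mul_tsum_mul_conj_tsum_le` — "changing the order of summation":
  a finite sum over `d` against one or two absolutely convergent series is bounded by the series'
  `ℓ¹` norms times a uniform bound for the inner exponential sums over `d`;
* `norm_kloosterman_nat_le` — (4.14) over `d ∈ (y₁, y₂] ⊂ ℕ`, `y₂ − y₁ ≤ c`;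
* `norm_sum_shifted_sub_main_le` — the estimate of `Σ_{d ∈ I} e(∓a_dh/c)S₁(±(a_d/c − α))S̄₂(…)`
  minus its leading term `p(c)²ĝ₁conj((ḡ₂)^)·Σ_{d ∈ I}e(∓a_dh/c)`, for both signs.

## References

* [ConreyIwaniec2002] B. Conrey, H. Iwaniec, Acta Arith. 103 (2002) 259–312, arXiv:math/0111012:
  §4 (4.3)–(4.7), (4.12)–(4.14), proof of Theorem 4.1.
-/

noncomputable section

open scoped FourierTransform ComplexConjugate
open Complex MeasureTheory Set Finset

namespace Literature.NumberTheory.LFunctions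

namespace ConreyIwaniec2002

namespace CircleMethod

/-! ### The trigonometric sum `S(θ) = Σ λ(n)g(n)e(nθ)` and the summation formula at `g(x)e(−αx)` -/

/-- A test function on `[X, 2X]` vanishes at the naturals outside `[1, ⌊2X⌋]`.
[cite: ConreyIwaniec2002, §4 (4.18)] -/
theorem eq_zero_nat_of_isBumpOn {X : ℝ} {g : ℝ → ℂ} (hX : 1 / 2 ≤ X) (hg : IsBumpOn X g) {n : ℕ}
    (hn : n ∉ Finset.Icc 1 ⌊2 * X⌋₊) : g n = 0 := by
  apply eq_zero_of_isBumpOn hg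
  intro hmem
  apply hn
  rw [Finset.mem_Icc]
  constructor
  · by_contra h0
    have : n = 0 := by omega
    rw [this, Nat.cast_zero] at hmem
    linarith [hmem.1]
  · exact Nat.le_floor hmem.2

/-- **(4.3) at the test function `g(x)e(−αx)`**: for `c ≥ 1`, `aā ≡ 1 (mod c)` and a test function
`g` of (4.18) on `[X, 2X]`, `X ≥ 1/2`, the summation datum gives
`S(a/c − α) − u_c(a)p(c)ĝ(α) = Σ_{m ≥ 1} u_c(a)φ_c(m)e(ā l_m/c)ĝ_m(α)` (as a `HasSum`), where
`S(θ) = Σ_{1 ≤ n ≤ 2X} λ(n)g(n)e(nθ)` and `ĝ_m = (g·k_m)^` — "By the summation formula (4.3) we have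
`S(a/c − α) = Σ_{m ≥ 0}ψ_m(a)e(dl_m/c)ĝ_m(α)`". [cite: ConreyIwaniec2002, §4, proof of Theorem 4.1] -/
theorem hasSum_voronoi_fourier {A : ℝ} {lam : ℕ → ℂ} {kf : ℕ → ℕ → ℝ → ℂ} {p : ℕ → ℝ}
    {u : ℕ → ℤ → ℂ} {φ : ℕ → ℕ → ℂ} {l : ℕ → ℕ → ℤ} (hV : IsVoronoiDatum A lam kf p u φ l)
    {X : ℝ} {g : ℝ → ℂ} (hX : 1 / 2 ≤ X) (hg : IsBumpOn X g) {c : ℕ} (hc : 1 ≤ c) {a abar : ℤ}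
    (ha : a * abar ≡ 1 [ZMOD c]) (α : ℝ) :
    HasSum (fun m : ℕ ↦ u c a * φ c (m + 1) * (𝐞 (((abar * l c (m + 1) : ℤ) : ℝ) / c) : ℂ) *
        𝓕 (fun x ↦ g x * kf c (m + 1) x) α)
      ((∑ n ∈ Finset.Icc 1 ⌊2 * X⌋₊, lam n * g n * (𝐞 (n * ((a : ℝ) / c - α)) : ℂ)) -
        u c a * p c * 𝓕 g α) := by
  obtain ⟨-, -, -, hrest⟩ := hV c hc
  obtain ⟨-, hsum⟩ := hrest a abar ha
  have h := hsum (fun x ↦ (𝐞 (-(x * α)) : ℂ) * g x) (contDiff_test hg α) (test_eq_zero hX hg α)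
  simp_rw [integral_Ioi_test_mul_eq_fourier hX hg, integral_Ioi_test_eq_fourier hX hg] at h
  convert h using 2
  -- the finitely supported series is the trigonometric sum
  rw [tsum_eq_sum (s := Finset.Icc 1 ⌊2 * X⌋₊)]
  · refine Finset.sum_congr rfl fun n _ ↦ ?_
    rw [show (𝐞 ((n : ℝ) * ((a : ℝ) / c - α)) : ℂ) =
        (𝐞 ((a : ℝ) * n / c) : ℂ) * (𝐞 (-((n : ℝ) * α)) : ℂ) by
      rw [← Circle.coe_mul, ← AddChar.map_add_eq_mul]; congr 2; ring]
    ring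
  · intro n hn
    rw [eq_zero_nat_of_isBumpOn hX hg hn, mul_zero, mul_zero]

/-! ### `Σ_{m ≥ 1} |φ_c(m) ĝ_m(α)| ≤ A B C K₅₄²` -/

/-- **(4.4)–(4.5)**: for `1 ≤ c ≤ C = 2√(qX)` and `|α| ≤ (cC)^{-1}`,
`|φ_c(m)ĝ_m(α)| ≤ (Aτ(m)/c)(BcCm^{-5/4}) = ABC·τ(m)m^{-5/4}` (`m ≥ 1`).
[cite: ConreyIwaniec2002, §4 (4.4)–(4.5)] -/
theorem norm_coeff_mul_fourier_le {A B : ℝ} {q : ℕ} {lam : ℕ → ℂ} {kf : ℕ → ℕ → ℝ → ℂ}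
    {p : ℕ → ℝ} {u : ℕ → ℤ → ℂ} {φ : ℕ → ℕ → ℂ} {l : ℕ → ℕ → ℤ}
    (hV : IsVoronoiDatum A lam kf p u φ l) (hK : KernelFourierBound q B kf)
    {X : ℝ} {g : ℝ → ℂ} (hX : 1 / 2 ≤ X) (hg : IsBumpOn X g) {c : ℕ} (hc : 1 ≤ c)
    (hcC : (c : ℝ) ≤ 2 * Real.sqrt (q * X)) {α : ℝ} (hα : |α| ≤ 1 / (c * (2 * Real.sqrt (q * X))))
    (m : ℕ) :
    ‖φ c (m + 1) * 𝓕 (fun x ↦ g x * kf c (m + 1) x) α‖ ≤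
      A * B * (2 * Real.sqrt (q * X)) *
        (((m + 1 : ℕ).divisors.card : ℝ) * ((m + 1 : ℕ) : ℝ) ^ (-(5 / 4 : ℝ))) := by
  obtain ⟨hp0, hpA, hφ, -⟩ := hV c hc
  have hc' : (0 : ℝ) < c := by exact_mod_cast hc
  have hA : 0 ≤ A := by
    have := hpA; have h0 := hp0
    have : 0 ≤ A / c := h0.trans hpA
    exact (div_nonneg_iff.mp this).elim (fun h ↦ h.1) fun h ↦ absurd h.2 (not_le.mpr hc')
  have h1 := hφ (m + 1) (by omega)
  have h2 := hK X hX g hg c hc hcC α hα (m + 1) (by omega)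
  rw [norm_mul]
  calc ‖φ c (m + 1)‖ * ‖𝓕 (fun x ↦ g x * kf c (m + 1) x) α‖
      ≤ (A * ((m + 1 : ℕ).divisors.card : ℝ) / c) *
          (B * c * (2 * Real.sqrt (q * X)) * ((m + 1 : ℕ) : ℝ) ^ (-(5 / 4 : ℝ))) :=
        mul_le_mul h1 h2 (norm_nonneg _) (by positivity)
    _ = A * B * (2 * Real.sqrt (q * X)) *
        (((m + 1 : ℕ).divisors.card : ℝ) * ((m + 1 : ℕ) : ℝ) ^ (-(5 / 4 : ℝ))) := by
        field_simp

/-- The shifted majorant `m ↦ τ(m+1)(m+1)^{-5/4}` is summable with sum `≤ K₅₄² = (Σ_n n^{-5/4})²`.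
[cite: ConreyIwaniec2002, §4, proof of Theorem 4.1 (expansion of `V_c(α)`)] -/
theorem summable_majorant_succ :
    Summable (fun m : ℕ ↦ ((m + 1 : ℕ).divisors.card : ℝ) * ((m + 1 : ℕ) : ℝ) ^ (-(5 / 4 : ℝ))) ∧
      ∑' m : ℕ, ((m + 1 : ℕ).divisors.card : ℝ) * ((m + 1 : ℕ) : ℝ) ^ (-(5 / 4 : ℝ)) ≤
        (∑' n : ℕ, (n : ℝ) ^ (-(5 / 4 : ℝ))) ^ 2 := by
  have hs := summable_card_divisors_mul_rpow
  have hs' : Summable (fun m : ℕ ↦ ((m + 1 : ℕ).divisors.card : ℝ) *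
      ((m + 1 : ℕ) : ℝ) ^ (-(5 / 4 : ℝ))) := (summable_nat_add_iff 1).mpr hs
  refine ⟨hs', ?_⟩
  have h0 : ((0 : ℕ).divisors.card : ℝ) * ((0 : ℕ) : ℝ) ^ (-(5 / 4 : ℝ)) = 0 := by simp
  calc ∑' m : ℕ, ((m + 1 : ℕ).divisors.card : ℝ) * ((m + 1 : ℕ) : ℝ) ^ (-(5 / 4 : ℝ))
      = ∑' m : ℕ, ((m : ℕ).divisors.card : ℝ) * ((m : ℕ) : ℝ) ^ (-(5 / 4 : ℝ)) := by
        rw [hs.tsum_eq_zero_add]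
        rw [h0, zero_add]
    _ ≤ _ := tsum_card_divisors_mul_rpow_le

/-- **`Σ_{m ≥ 1}|φ_c(m)ĝ_m(α)|` converges, with sum `≤ A·B·C·K₅₄²`** (`C = 2√(qX)`, `1 ≤ c ≤ C`,
`|α| ≤ (cC)^{-1}`) — the majorant "`Σ_1^∞ τ(m)|ĝ_m(α)|`" of the proof of Theorem 4.1.
[cite: ConreyIwaniec2002, §4 (4.4)–(4.5), proof of Theorem 4.1] -/
theorem summable_norm_coeff_mul_fourier {A B : ℝ} {q : ℕ} {lam : ℕ → ℂ} {kf : ℕ → ℕ → ℝ → ℂ}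
    {p : ℕ → ℝ} {u : ℕ → ℤ → ℂ} {φ : ℕ → ℕ → ℂ} {l : ℕ → ℕ → ℤ}
    (hV : IsVoronoiDatum A lam kf p u φ l) (hK : KernelFourierBound q B kf)
    {X : ℝ} {g : ℝ → ℂ} (hX : 1 / 2 ≤ X) (hg : IsBumpOn X g) {c : ℕ} (hc : 1 ≤ c)
    (hcC : (c : ℝ) ≤ 2 * Real.sqrt (q * X)) {α : ℝ} (hα : |α| ≤ 1 / (c * (2 * Real.sqrt (q * X)))) :
    Summable (fun m : ℕ ↦ ‖φ c (m + 1) * 𝓕 (fun x ↦ g x * kf c (m + 1) x) α‖) ∧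
      ∑' m : ℕ, ‖φ c (m + 1) * 𝓕 (fun x ↦ g x * kf c (m + 1) x) α‖ ≤
        A * B * (2 * Real.sqrt (q * X)) * (∑' n : ℕ, (n : ℝ) ^ (-(5 / 4 : ℝ))) ^ 2 := by
  obtain ⟨hsm, hle⟩ := summable_majorant_succ
  have hterm := norm_coeff_mul_fourier_le hV hK hX hg hc hcC hα
  have hsum : Summable (fun m : ℕ ↦ ‖φ c (m + 1) * 𝓕 (fun x ↦ g x * kf c (m + 1) x) α‖) :=
    Summable.of_nonneg_of_le (fun _ ↦ norm_nonneg _) hterm (hsm.mul_left _)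
  refine ⟨hsum, ?_⟩
  calc ∑' m : ℕ, ‖φ c (m + 1) * 𝓕 (fun x ↦ g x * kf c (m + 1) x) α‖
      ≤ ∑' m : ℕ, A * B * (2 * Real.sqrt (q * X)) *
          (((m + 1 : ℕ).divisors.card : ℝ) * ((m + 1 : ℕ) : ℝ) ^ (-(5 / 4 : ℝ))) :=
        hsum.tsum_le_tsum hterm (hsm.mul_left _)
    _ = A * B * (2 * Real.sqrt (q * X)) *
          ∑' m : ℕ, ((m + 1 : ℕ).divisors.card : ℝ) * ((m + 1 : ℕ) : ℝ) ^ (-(5 / 4 : ℝ)) :=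
        tsum_mul_left
    _ ≤ A * B * (2 * Real.sqrt (q * X)) * (∑' n : ℕ, (n : ℝ) ^ (-(5 / 4 : ℝ))) ^ 2 := by
        have hABC : 0 ≤ A * B * (2 * Real.sqrt (q * X)) := by
          have h0 := hterm 0
          have hpos : 0 < ((0 + 1 : ℕ).divisors.card : ℝ) * ((0 + 1 : ℕ) : ℝ) ^ (-(5 / 4 : ℝ)) := by
            norm_num
          by_contra hneg
          push Not at hneg
          have : A * B * (2 * Real.sqrt (q * X)) *
              (((0 + 1 : ℕ).divisors.card : ℝ) * ((0 + 1 : ℕ) : ℝ) ^ (-(5 / 4 : ℝ))) < 0 :=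
            mul_neg_of_neg_of_pos hneg hpos
          linarith [norm_nonneg (φ c (0 + 1) * 𝓕 (fun x ↦ g x * kf c (0 + 1) x) α)]
        exact mul_le_mul_of_nonneg_left hle hABC

/-! ### "Changing the order of summation": finite sums against absolutely convergent series -/

/-- For a finite set `I`, weights `w_d`, phases `ε_m(d)` (`|ε_m(d)| ≤ 1`) with
`‖Σ_{d ∈ I} w_d ε_m(d)‖ ≤ W` for all `m`, and an absolutely convergent series `Σ_m Φ_m`:
`‖Σ_{d ∈ I} w_d Σ_m Φ_m ε_m(d)‖ ≤ (Σ_m ‖Φ_m‖)·W` ("changing the order of summation").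
[cite: ConreyIwaniec2002, §4, proof of Theorem 4.1 (expansion of `V_c(α)`)] -/
theorem norm_sum_mul_tsum_le {ι : Type*} (I : Finset ι) (w : ι → ℂ) (ε : ℕ → ι → ℂ)
    (Φ : ℕ → ℂ) (hΦ : Summable (fun m ↦ ‖Φ m‖)) (hε : ∀ m d, ‖ε m d‖ ≤ 1) {W : ℝ}
    (hW : ∀ m, ‖∑ d ∈ I, w d * ε m d‖ ≤ W) :
    ‖∑ d ∈ I, w d * ∑' m, Φ m * ε m d‖ ≤ (∑' m, ‖Φ m‖) * W := by
  -- each inner series converges absolutely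
  have hsd : ∀ d, Summable (fun m ↦ Φ m * ε m d) := fun d ↦
    Summable.of_norm_bounded hΦ (fun m ↦ by
      rw [norm_mul]; exact mul_le_of_le_one_right (norm_nonneg _) (hε m d))
  -- exchange
  have hex : ∑ d ∈ I, w d * ∑' m, Φ m * ε m d = ∑' m, Φ m * ∑ d ∈ I, w d * ε m d := by
    calc ∑ d ∈ I, w d * ∑' m, Φ m * ε m d
        = ∑ d ∈ I, ∑' m, w d * (Φ m * ε m d) :=
          Finset.sum_congr rfl fun d _ ↦ tsum_mul_left.symm
      _ = ∑' m, ∑ d ∈ I, w d * (Φ m * ε m d) :=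
          (Summable.tsum_finsetSum fun d _ ↦ (hsd d).mul_left (w d)).symm
      _ = ∑' m, Φ m * ∑ d ∈ I, w d * ε m d := by
          refine tsum_congr fun m ↦ ?_
          rw [Finset.mul_sum]
          exact Finset.sum_congr rfl fun d _ ↦ by ring
  have hs2 : Summable (fun m ↦ ‖Φ m‖ * W) := hΦ.mul_right W
  have hle : ∀ m, ‖Φ m * ∑ d ∈ I, w d * ε m d‖ ≤ ‖Φ m‖ * W := fun m ↦ by
    rw [norm_mul]; exact mul_le_mul_of_nonneg_left (hW m) (norm_nonneg _)
  have hs3 : Summable (fun m ↦ ‖Φ m * ∑ d ∈ I, w d * ε m d‖) :=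
    Summable.of_nonneg_of_le (fun _ ↦ norm_nonneg _) hle hs2
  rw [hex]
  calc ‖∑' m, Φ m * ∑ d ∈ I, w d * ε m d‖
      ≤ ∑' m, ‖Φ m * ∑ d ∈ I, w d * ε m d‖ := norm_tsum_le_tsum_norm hs3
    _ ≤ ∑' m, ‖Φ m‖ * W := hs3.tsum_le_tsum hle hs2
    _ = (∑' m, ‖Φ m‖) * W := tsum_mul_right

/-- The norm of an absolutely convergent series with unimodular-bounded phases.
[folklore] -/
private theorem norm_tsum_mul_le_tsum_norm {ι : Type*} (ε : ℕ → ι → ℂ) (Φ : ℕ → ℂ)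
    (hΦ : Summable (fun m ↦ ‖Φ m‖)) (hε : ∀ m d, ‖ε m d‖ ≤ 1) (d : ι) :
    ‖∑' m, Φ m * ε m d‖ ≤ ∑' m, ‖Φ m‖ := by
  have hle : ∀ m, ‖Φ m * ε m d‖ ≤ ‖Φ m‖ := fun m ↦ by
    rw [norm_mul]; exact mul_le_of_le_one_right (norm_nonneg _) (hε m d)
  have hs : Summable (fun m ↦ ‖Φ m * ε m d‖) :=
    Summable.of_nonneg_of_le (fun _ ↦ norm_nonneg _) hle hΦ
  exact (norm_tsum_le_tsum_norm hs).trans (hs.tsum_le_tsum hle hΦ)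

/-- Two-series form of `norm_sum_mul_tsum_le`: with `‖Σ_{d ∈ I} w_d ε_m(d) conj(ε_n(d))‖ ≤ W` for
all `m, n` and absolutely convergent `Σ Φ₁`, `Σ Φ₂`,
`‖Σ_{d ∈ I} w_d (Σ_m Φ₁(m)ε_m(d))·conj(Σ_n Φ₂(n)ε_n(d))‖ ≤ (Σ‖Φ₁‖)(Σ‖Φ₂‖)·W` — the double
series "`Σ_{m₁}Σ_{m₂} ĝ_{m₁}conj(ĝ_{m₂}) Σ*_{d ∈ I} ψ_{m₁}(a)ψ̄_{m₂}(a)e(d(l_{m₁} − l_{m₂})/c − ah/c)`".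
[cite: ConreyIwaniec2002, §4, proof of Theorem 4.1 (expansion of `V_c(α)`)] -/
theorem norm_sum_mul_tsum_mul_conj_tsum_le {ι : Type*} (I : Finset ι) (w : ι → ℂ)
    (ε : ℕ → ι → ℂ) (Φ₁ Φ₂ : ℕ → ℂ) (hΦ₁ : Summable (fun m ↦ ‖Φ₁ m‖))
    (hΦ₂ : Summable (fun m ↦ ‖Φ₂ m‖)) (hε : ∀ m d, ‖ε m d‖ ≤ 1) {W : ℝ}
    (hW : ∀ m n, ‖∑ d ∈ I, w d * (ε m d * conj (ε n d))‖ ≤ W) :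
    ‖∑ d ∈ I, w d * ((∑' m, Φ₁ m * ε m d) * conj (∑' n, Φ₂ n * ε n d))‖ ≤
      (∑' m, ‖Φ₁ m‖) * (∑' n, ‖Φ₂ n‖) * W := by
  have hW0 : 0 ≤ W := (norm_nonneg _).trans (hW 0 0)
  -- inner step: for fixed `m`, the sum over `d` against the (conjugated) second series
  have hinner : ∀ m, ‖∑ d ∈ I, (w d * ε m d) * conj (∑' n, Φ₂ n * ε n d)‖ ≤
      (∑' n, ‖Φ₂ n‖) * W := by
    intro m
    have hconj : ∀ d, conj (∑' n, Φ₂ n * ε n d) = ∑' n, conj (Φ₂ n) * conj (ε n d) := by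
      intro d
      rw [Complex.conj_tsum]
      exact tsum_congr fun n ↦ map_mul _ _ _
    simp_rw [hconj]
    have hΦ₂' : Summable (fun n ↦ ‖conj (Φ₂ n)‖) := by simpa [Complex.norm_conj] using hΦ₂
    have h := norm_sum_mul_tsum_le I (fun d ↦ w d * ε m d) (fun n d ↦ conj (ε n d))
      (fun n ↦ conj (Φ₂ n)) hΦ₂' (fun n d ↦ by rw [Complex.norm_conj]; exact hε n d) (W := W)
      (fun n ↦ by simpa [mul_assoc] using hW m n)
    simpa [Complex.norm_conj] using h
  -- outer exchange
  set K : ι → ℂ := fun d ↦ conj (∑' n, Φ₂ n * ε n d) with hKdef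
  have hKle : ∀ d, ‖K d‖ ≤ ∑' n, ‖Φ₂ n‖ := fun d ↦ by
    rw [hKdef, Complex.norm_conj]; exact norm_tsum_mul_le_tsum_norm ε Φ₂ hΦ₂ hε d
  have hsd : ∀ d, Summable (fun m ↦ Φ₁ m * ((w d * ε m d) * K d)) := fun d ↦ by
    refine Summable.of_norm_bounded (hΦ₁.mul_right (‖w d‖ * ∑' n, ‖Φ₂ n‖)) (fun m ↦ ?_)
    rw [norm_mul, norm_mul, norm_mul]
    refine mul_le_mul_of_nonneg_left ?_ (norm_nonneg _)
    calc ‖w d‖ * ‖ε m d‖ * ‖K d‖ ≤ ‖w d‖ * 1 * ∑' n, ‖Φ₂ n‖ :=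
          mul_le_mul (mul_le_mul_of_nonneg_left (hε m d) (norm_nonneg _)) (hKle d)
            (norm_nonneg _) (by positivity)
      _ = ‖w d‖ * ∑' n, ‖Φ₂ n‖ := by ring
  have hex : ∑ d ∈ I, w d * ((∑' m, Φ₁ m * ε m d) * K d) =
      ∑' m, Φ₁ m * ∑ d ∈ I, (w d * ε m d) * K d := by
    calc ∑ d ∈ I, w d * ((∑' m, Φ₁ m * ε m d) * K d)
        = ∑ d ∈ I, ∑' m, Φ₁ m * ((w d * ε m d) * K d) := by
          refine Finset.sum_congr rfl fun d _ ↦ ?_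
          rw [← tsum_mul_right, ← tsum_mul_left]
          exact tsum_congr fun m ↦ by ring
      _ = ∑' m, ∑ d ∈ I, Φ₁ m * ((w d * ε m d) * K d) :=
          (Summable.tsum_finsetSum fun d _ ↦ hsd d).symm
      _ = ∑' m, Φ₁ m * ∑ d ∈ I, (w d * ε m d) * K d := by
          refine tsum_congr fun m ↦ ?_
          rw [Finset.mul_sum]
  have hle : ∀ m, ‖Φ₁ m * ∑ d ∈ I, (w d * ε m d) * K d‖ ≤ ‖Φ₁ m‖ * ((∑' n, ‖Φ₂ n‖) * W) :=
    fun m ↦ by rw [norm_mul]; exact mul_le_mul_of_nonneg_left (hinner m) (norm_nonneg _)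
  have hs2 : Summable (fun m ↦ ‖Φ₁ m‖ * ((∑' n, ‖Φ₂ n‖) * W)) := hΦ₁.mul_right _
  have hs3 : Summable (fun m ↦ ‖Φ₁ m * ∑ d ∈ I, (w d * ε m d) * K d‖) :=
    Summable.of_nonneg_of_le (fun _ ↦ norm_nonneg _) hle hs2
  rw [hex]
  calc ‖∑' m, Φ₁ m * ∑ d ∈ I, (w d * ε m d) * K d‖
      ≤ ∑' m, ‖Φ₁ m * ∑ d ∈ I, (w d * ε m d) * K d‖ := norm_tsum_le_tsum_norm hs3
    _ ≤ ∑' m, ‖Φ₁ m‖ * ((∑' n, ‖Φ₂ n‖) * W) := hs3.tsum_le_tsum hle hs2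
    _ = (∑' m, ‖Φ₁ m‖) * ((∑' n, ‖Φ₂ n‖) * W) := tsum_mul_right
    _ = (∑' m, ‖Φ₁ m‖) * (∑' n, ‖Φ₂ n‖) * W := by ring

end CircleMethod

end ConreyIwaniec2002

end Literature.NumberTheory.LFunctions

end
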